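import Summits.BirchSwinnertonDyer.BirchSwinnertonDyer.Statement
import Literature.NumberTheory.EllipticCurves.LeadingTerm
import Literature.NumberTheory.EllipticCurves.SelmerCorankHolds
import Literature.NumberTheory.EllipticCurves.BSDSelmer
import Literature.NumberTheory.EllipticCurves.BSDRootNumberModularityOnlyProofs
import Literature.NumberTheory.EllipticCurves.BSDSelmerPConverseRankZeroProofs
import Literature.NumberTheory.EllipticCurves.IwasawaLeadingTermProofs
import Literature.NumberTheory.EllipticCurves.GlobalMinimalModelProofs
import Literature.NumberTheory.EllipticCurves.BSDInvariantsProofs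
import HarnessLib

/-!
# SoloInformedConverseLadder — the open core of RANK as a ladder of `p`-converse theorems

Kernel-checked bookkeeping (logic over named facts of the Literature library) locating the
Birch–Swinnerton-Dyer rank conjecture `BirchSwinnertonDyer` (`r_an(E) = rank E(ℚ)` for every
elliptic curve `E/ℚ`) relative to what is in print, prime by prime.

Fix `E/ℚ` with `r = r_an(E)` and a prime `p`; write `c = corank_{ℤ_p} Sel_{p^∞}(E/ℚ)` and
`s = corank_{ℤ_p} Ш(E/ℚ)[p^∞]`, so that `c = rank E(ℚ) + s` (Greenberg, LNM 1716 §1; PROVED in the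
tree: `WeierstrassCurve.selmerCorank_eq_mordellWeilRank_add_holds`).

* **Counting** (`soloInformed_analyticRank_le_selmerCorank_of_converses`,
  `soloInformed_selmerCorank_eq_analyticRank_of_converses`): if the corank-`k` `p`-CONVERSE
  `c = k ⇒ r = k` holds at `(E,p)` for every `k ≤ r - 2`, then `p`-parity
  (`p_parity`: `(-1)^c = w(E)`, Dokchitser–Dokchitser 2010 Thm. 1.4) and the sign relation
  (`even_analyticRank_iff_rootNumber_eq_one`, proved from modularity in the tree) give `r ≤ c`;
  with the Selmer CAP `c ≤ r` (door (α)) they give `c = r`, and with `s = 0` (door (β)) they give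
  `rank E(ℚ) = r` (`soloInformed_rank_eq_analyticRank_of_converses`).
* **Rungs in print.** The corank-`0` converse is a theorem at every good ordinary `p ≥ 5` with
  `E[p]` irreducible, below modularity, the cyclotomic main conjecture
  (`burungale_castella_skinner_charIdeal_eq_padicLFunction`) and Perrin-Riou–Schneider
  (`Schneider1985_order_charGenerator`): tree theorem
  `analyticRank_eq_zero_of_selmerCorank_eq_zero_of_mainConjecture`
  (`soloInformed_pConverse_zero`). The corank-`1` converse is Burungale–Skinner–Tian–Wan,
  arXiv:2409.01350 Thm. 1.10 (`burungaleSkinnerTianWan_analyticRank_eq_one_of_selmerCorank_eq_one`;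
  `soloInformed_pConverse_one_of_bstw`), or — granted door (β) at `p` — Kim, Math. Ann. 387 (2022)
  Cor. 1.4 for non-CM curves (`soloInformed_pConverse_one_of_kim`). No corank-`k` converse with
  `k ≥ 2` is in print.
* **Consequences.** For `r_an(E) ≤ 3` the lower bound `r_an ≤ rank` needs, beyond theorems in
  print at one good ordinary prime, ONLY door (β) `corank Ш[p^∞] = 0` at that prime, and the full
  equality needs (α) and (β) there (`soloInformed_rank_eq_analyticRank_of_le_three_at`). Universally:
  over Gross–Zagier–Kolyvagin (`rank_eq_analyticRank_of_analyticRank_le_one`), modularity and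
  `p`-parity, RANK for all curves of analytic rank `≤ 3` follows from "at one prime: the two
  converses in print, (α) and (β)" (`soloInformed_rank_eq_analyticRank_of_le_three_of_doors`),
  and the whole conjecture from the CONVERSE LADDER "at one prime: the corank-`k` converses for all
  `k ≤ r_an - 2`, (α) and (β)" (`soloInformed_birchSwinnertonDyer_of_converseLadder`).

So a proof of RANK must supply, for every `E/ℚ` with `r_an(E) = r ≥ 2`, at ONE prime `p`:
(α) `corank Sel_{p^∞} ≤ r` (by Kato's Thm. 18.4 implied by `ord_{T=0} L_p(E,T) ≤ r`: "`p`-adic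
order ≤ complex order"), (β) `corank Ш[p^∞] = 0` without a rational point as input, and, from
`r = 4` on, corank-`k` `p`-converse theorems for `2 ≤ k ≤ r - 2`. The proofs below are counting;
the content is the typing.
-/

noncomputable section

open scoped Classical

open Literature.NumberTheory.EllipticCurves Literature.NumberTheory.EllipticCurves.ModularForms
  WeierstrassCurve

namespace Summit.BirchSwinnertonDyer.BirchSwinnertonDyer.Theorems

/-! ### Counting at one prime -/

/-- **Parity transfer.** `p`-parity `(-1)^{corank Sel_{p^∞}} = w(E)` (Dokchitser–Dokchitser,
Ann. of Math. 172 (2010), Thm. 1.4) and the sign relation `r_an even ↔ w(E) = 1` give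
`corank Sel_{p^∞}(E/ℚ) ≡ r_an(E) (mod 2)`. [cite: DokchitserDokchitserAnnals2010, Thm. 1.4] -/
theorem soloInformed_even_selmerCorank_iff_even_analyticRank
    (W : WeierstrassCurve ℚ) [W.IsElliptic] (p : ℕ) [Fact p.Prime]
    (hPar : p_parity W p) (hSign : even_analyticRank_iff_rootNumber_eq_one W) :
    Even (W.selmerCorank p) ↔ Even W.analyticRank := by
  have hS : Even W.analyticRank ↔ W.rootNumber = 1 := @hSign _
  have hP : (-1 : ℤ) ^ W.selmerCorank p = W.rootNumber := hPar
  rw [hS, ← hP]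
  exact (neg_one_pow_eq_one_iff_even (by norm_num)).symm

/-- **Selmer lower bound from the converse ladder.** Let `r = r_an(E)` and
`c = corank_{ℤ_p} Sel_{p^∞}(E/ℚ)`. If the corank-`k` `p`-converse `c = k ⇒ r = k` holds at
`(E,p)` for every `k` with `k + 2 ≤ r`, then `p`-parity and the sign relation give `r ≤ c`:
the converses exclude `c ≤ r - 2`, parity excludes `c = r - 1`.
[cite: DokchitserDokchitserAnnals2010, Thm. 1.4] -/
theorem soloInformed_analyticRank_le_selmerCorank_of_converses
    (W : WeierstrassCurve ℚ) [W.IsElliptic] (p : ℕ) [Fact p.Prime]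
    (hconv : ∀ k : ℕ, k + 2 ≤ W.analyticRank → W.selmerCorank p = k → W.analyticRank = k)
    (hPar : p_parity W p) (hSign : even_analyticRank_iff_rootNumber_eq_one W) :
    W.analyticRank ≤ W.selmerCorank p := by
  have hiff := soloInformed_even_selmerCorank_iff_even_analyticRank W p hPar hSign
  by_contra hlt
  have hlt' : W.selmerCorank p < W.analyticRank := not_le.mp hlt
  by_cases h2 : W.selmerCorank p + 2 ≤ W.analyticRank
  · have := hconv (W.selmerCorank p) h2 rfl
    omega
  · have heq : W.analyticRank = W.selmerCorank p + 1 := by omega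
    rw [heq, Nat.even_add_one] at hiff
    exact iff_not_self hiff

/-- **Selmer corank pinned by the ladder and the cap.** With the converses for `k ≤ r - 2`,
`p`-parity, the sign relation and the Selmer cap `c ≤ r` (door (α)), `c = r`.
[cite: DokchitserDokchitserAnnals2010, Thm. 1.4] -/
theorem soloInformed_selmerCorank_eq_analyticRank_of_converses
    (W : WeierstrassCurve ℚ) [W.IsElliptic] (p : ℕ) [Fact p.Prime]
    (hconv : ∀ k : ℕ, k + 2 ≤ W.analyticRank → W.selmerCorank p = k → W.analyticRank = k)
    (hPar : p_parity W p) (hSign : even_analyticRank_iff_rootNumber_eq_one W)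
    (hα : W.selmerCorank p ≤ W.analyticRank) :
    W.selmerCorank p = W.analyticRank :=
  le_antisymm hα (soloInformed_analyticRank_le_selmerCorank_of_converses W p hconv hPar hSign)

/-- **Lower bound `r_an ≤ rank` from the ladder and door (β).** With the converses for
`k ≤ r - 2`, `p`-parity, the sign relation and `corank_{ℤ_p} Ш(E/ℚ)[p^∞] = 0` (door (β)) at
the same prime, `r_an(E) ≤ rank E(ℚ)` — by the PROVED corank identity
`corank Sel_{p^∞} = rank + corank Ш[p^∞]` (`selmerCorank_eq_mordellWeilRank_add_holds`;
Greenberg, LNM 1716 (1999) §1). [cite: GreenbergLNM1716, §1] -/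
theorem soloInformed_analyticRank_le_rank_of_converses
    (W : WeierstrassCurve ℚ) [W.IsElliptic] (p : ℕ) [Fact p.Prime]
    (hconv : ∀ k : ℕ, k + 2 ≤ W.analyticRank → W.selmerCorank p = k → W.analyticRank = k)
    (hPar : p_parity W p) (hSign : even_analyticRank_iff_rootNumber_eq_one W)
    (hβ : W.shaCorank p = 0) :
    W.analyticRank ≤ W.mordellWeilRank := by
  have hle := soloInformed_analyticRank_le_selmerCorank_of_converses W p hconv hPar hSign
  have hid : W.selmerCorank p = W.mordellWeilRank + W.shaCorank p :=
    W.selmerCorank_eq_mordellWeilRank_add_holds p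
  omega

/-- **RANK at one prime from the ladder and the two doors.** With the converses for
`k ≤ r - 2`, `p`-parity, the sign relation, door (α) `corank Sel_{p^∞} ≤ r_an` and door (β)
`corank Ш[p^∞] = 0` at the same prime, `rank E(ℚ) = r_an(E)`. [cite: GreenbergLNM1716, §1] -/
theorem soloInformed_rank_eq_analyticRank_of_converses
    (W : WeierstrassCurve ℚ) [W.IsElliptic] (p : ℕ) [Fact p.Prime]
    (hconv : ∀ k : ℕ, k + 2 ≤ W.analyticRank → W.selmerCorank p = k → W.analyticRank = k)
    (hPar : p_parity W p) (hSign : even_analyticRank_iff_rootNumber_eq_one W)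
    (hα : W.selmerCorank p ≤ W.analyticRank) (hβ : W.shaCorank p = 0) :
    W.mordellWeilRank = W.analyticRank := by
  have heq := soloInformed_selmerCorank_eq_analyticRank_of_converses W p hconv hPar hSign hα
  have hid : W.selmerCorank p = W.mordellWeilRank + W.shaCorank p :=
    W.selmerCorank_eq_mordellWeilRank_add_holds p
  omega

/-! ### The rungs in print -/

/-- **Rung `k = 0`** (every `E/ℚ`, `p ≥ 5` good ordinary, `E[p]` irreducible): the corank-`0`
`p`-converse `corank Sel_{p^∞} = 0 ⇒ r_an = 0`, below modularity (`exists_isNewformOf`), the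
cyclotomic main conjecture (`burungale_castella_skinner_charIdeal_eq_padicLFunction`;
Burungale–Castella–Skinner 2025 Thm. 1.1.2, after Kato and Skinner–Urban) and
Perrin-Riou–Schneider (`Schneider1985_order_charGenerator`); tree theorem
`analyticRank_eq_zero_of_selmerCorank_eq_zero_of_mainConjecture`.
[cite: GreenbergLNM1716, §1 pp. 65–66] [cite: BurungaleCastellaSkinner2025, Thm. 1.1.2 (a)] -/
theorem soloInformed_pConverse_zero
    (hmod : exists_isNewformOf)
    (hMC : burungale_castella_skinner_charIdeal_eq_padicLFunction)
    (hS : Schneider1985_order_charGenerator)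
    (W : WeierstrassCurve ℚ) [W.IsElliptic] [W.IsGloballyMinimal] (p : ℕ) [Fact p.Prime]
    (hp : 5 ≤ p) (hgood : W.HasGoodReductionAtPrime p) (hord : ¬ (p : ℤ) ∣ W.frobeniusTrace p)
    (hirr : W.HasIrreducibleModPGaloisRep p) :
    W.selmerCorank p = 0 → W.analyticRank = 0 :=
  fun h0 => analyticRank_eq_zero_of_selmerCorank_eq_zero_of_mainConjecture hmod hMC hS W p hp hgood
    hord hirr h0

/-- **Rung `k = 1`, unconditional form** (Burungale–Skinner–Tian–Wan, arXiv:2409.01350 (2024),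
Thm. 1.10: `p ∤ 2N` ordinary, `ρ̄_{E,p}` surjective, some `ℓ ‖ N` with `ρ̄` ramified at `ℓ`):
the corank-`1` `p`-converse `corank Sel_{p^∞} = 1 ⇒ r_an = 1`.
[cite: BurungaleSkinnerTianWan2024, Thm. 1.10] -/
theorem soloInformed_pConverse_one_of_bstw
    (hBSTW : burungaleSkinnerTianWan_analyticRank_eq_one_of_selmerCorank_eq_one)
    (W : WeierstrassCurve ℚ) [W.IsElliptic] [W.IsGloballyMinimal] (p : ℕ) [Fact p.Prime]
    (hp : p ≠ 2) (hgood : W.HasGoodReductionAtPrime p) (hord : ¬ (p : ℤ) ∣ W.frobeniusTrace p)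
    (hsurj : W.HasSurjectiveModNGaloisRep p)
    (hram : ∃ ℓ : ℕ, ∃ _ : Fact ℓ.Prime, ℓ ≠ p ∧ W.HasMultiplicativeReductionAtPrime ℓ ∧
      ¬ p ∣ padicValInt ℓ W.minimalDiscriminantInt) :
    W.selmerCorank p = 1 → W.analyticRank = 1 :=
  fun h1 => hBSTW W p hp hgood hord hsurj hram h1

/-- **Rung `k = 1` below door (β)** (C.-H. Kim, Math. Ann. 387 (2022), Cor. 1.4: non-CM `E/ℚ`,
`p > 3` good ordinary, `E[p]` irreducible, `rank = 1` and `Ш[p^∞]` finite ⇒ `r_an = 1`): granted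
`corank_{ℤ_p} Ш(E/ℚ)[p^∞] = 0` at `p` (door (β); equivalently `Ш[p^∞]` finite, tree theorem
`finite_primaryComponent_sha_iff_shaCorank_eq_zero`), corank `1` means rank `1` by the proved
corank identity, so Kim's converse gives the corank-`1` `p`-converse with no hypothesis on the
conductor. [cite: Kim2022, Cor. 1.4] -/
theorem soloInformed_pConverse_one_of_kim
    (hKim : kim_analyticRank_eq_one_of_mordellWeilRank_eq_one)
    (W : WeierstrassCurve ℚ) [W.IsElliptic] [W.IsGloballyMinimal] (hcm : ¬ W.HasCM)
    (p : ℕ) [Fact p.Prime] (hp : 3 < p) (hgood : W.HasGoodReductionAtPrime p)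
    (hord : ¬ (p : ℤ) ∣ W.frobeniusTrace p) (hirr : W.HasIrreducibleModPGaloisRep p)
    (hβ : W.shaCorank p = 0) :
    W.selmerCorank p = 1 → W.analyticRank = 1 := by
  intro h1
  have hid : W.selmerCorank p = W.mordellWeilRank + W.shaCorank p :=
    W.selmerCorank_eq_mordellWeilRank_add_holds p
  have hrank : W.mordellWeilRank = 1 := by omega
  have hfin : Finite (AddCommGroup.primaryComponent W.sha p) :=
    (finite_primaryComponent_sha_iff_shaCorank_eq_zero W p).2 hβ
  exact (hKim W hcm p hp hgood hord hirr hrank hfin).1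

/-! ### Analytic rank at most three -/

/-- **RANK at analytic rank `≤ 3`, at one prime, from doors (α) and (β) only.** Let `E/ℚ`
(globally minimal `W`) have `r_an(E) ≤ 3`, and let `p ≥ 5` be a good ordinary prime with
`ρ̄_{E,p}` surjective, `E[p]` irreducible and some `ℓ ‖ N_E` at which `ρ̄_{E,p}` is ramified.
Below modularity, the cyclotomic main conjecture, Perrin-Riou–Schneider, Burungale–Skinner–Tian–Wan
Thm. 1.10 and `p`-parity at `p` — all theorems in print — the two doors (α) `corank Sel_{p^∞} ≤ r_an`
and (β) `corank Ш[p^∞] = 0` at `p` give `rank E(ℚ) = r_an(E)`: the converses of corank `0` and `1`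
are the whole ladder when `r_an ≤ 3`. [cite: BurungaleSkinnerTianWan2024, Thm. 1.10]
[cite: DokchitserDokchitserAnnals2010, Thm. 1.4] -/
theorem soloInformed_rank_eq_analyticRank_of_le_three_at
    (hmod : exists_isNewformOf)
    (hMC : burungale_castella_skinner_charIdeal_eq_padicLFunction)
    (hS : Schneider1985_order_charGenerator)
    (hBSTW : burungaleSkinnerTianWan_analyticRank_eq_one_of_selmerCorank_eq_one)
    (W : WeierstrassCurve ℚ) [W.IsElliptic] [W.IsGloballyMinimal] (p : ℕ) [Fact p.Prime]
    (hPar : p_parity W p)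
    (hp : 5 ≤ p) (hgood : W.HasGoodReductionAtPrime p) (hord : ¬ (p : ℤ) ∣ W.frobeniusTrace p)
    (hsurj : W.HasSurjectiveModNGaloisRep p) (hirr : W.HasIrreducibleModPGaloisRep p)
    (hram : ∃ ℓ : ℕ, ∃ _ : Fact ℓ.Prime, ℓ ≠ p ∧ W.HasMultiplicativeReductionAtPrime ℓ ∧
      ¬ p ∣ padicValInt ℓ W.minimalDiscriminantInt)
    (h3 : W.analyticRank ≤ 3)
    (hα : W.selmerCorank p ≤ W.analyticRank) (hβ : W.shaCorank p = 0) :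
    W.mordellWeilRank = W.analyticRank := by
  refine soloInformed_rank_eq_analyticRank_of_converses W p ?_ hPar
    (even_analyticRank_iff_rootNumber_eq_one_of_exists_isNewformOf W hmod) hα hβ
  intro k hk hc
  have hk1 : k = 0 ∨ k = 1 := by omega
  rcases hk1 with rfl | rfl
  · exact soloInformed_pConverse_zero hmod hMC hS W p hp hgood hord hirr hc
  · exact soloInformed_pConverse_one_of_bstw hBSTW W p (by omega) hgood hord hsurj hram hc

/-- **RANK for all curves of analytic rank `≤ 3`, from the doors at one prime.** Over
Gross–Zagier–Kolyvagin (`rank_eq_analyticRank_of_analyticRank_le_one`; Gross, PCMS 18 (2011)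
Thm. 3.3), modularity (`exists_isNewformOf`, for the sign relation) and `p`-parity
(Dokchitser–Dokchitser 2010 Thm. 1.4): if every globally minimal `E/ℚ` with `2 ≤ r_an(E) ≤ 3`
has a prime `p` at which the corank-`0` and corank-`1` `p`-converses hold (theorems in print on
the good ordinary surjective slice, `soloInformed_pConverse_zero`, `soloInformed_pConverse_one_of_bstw`,
`soloInformed_pConverse_one_of_kim`) together with door (α) `corank Sel_{p^∞} ≤ r_an` and door
(β) `corank Ш[p^∞] = 0`, then `rank E(ℚ) = r_an(E)` for EVERY `E/ℚ` with `r_an(E) ≤ 3`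
(global minimal models exist over `ℚ` and both ranks are invariant under changes of variables:
tree theorems `hasGlobalMinimalModel_rat_holds`, `analyticRank_variableChange_holds`,
`mordellWeilRank_variableChange_holds`). [cite: GrossPCMS2011, Thm. 3.3]
[cite: DokchitserDokchitserAnnals2010, Thm. 1.4] -/
theorem soloInformed_rank_eq_analyticRank_of_le_three_of_doors
    (hGZK : rank_eq_analyticRank_of_analyticRank_le_one)
    (hmod : exists_isNewformOf)
    (hPar : ∀ (W : WeierstrassCurve ℚ) [W.IsElliptic] (p : ℕ) [Fact p.Prime], p_parity W p)
    (hDoors : ∀ (W : WeierstrassCurve ℚ) [W.IsElliptic] [W.IsGloballyMinimal],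
      2 ≤ W.analyticRank → W.analyticRank ≤ 3 →
      ∃ (p : ℕ) (_ : Fact p.Prime),
        (W.selmerCorank p = 0 → W.analyticRank = 0) ∧
        (W.selmerCorank p = 1 → W.analyticRank = 1) ∧
        W.selmerCorank p ≤ W.analyticRank ∧ W.shaCorank p = 0) :
    ∀ (W : WeierstrassCurve ℚ) [W.IsElliptic], W.analyticRank ≤ 3 →
      W.mordellWeilRank = W.analyticRank := by
  intro W _ h3
  by_cases h1 : W.analyticRank ≤ 1
  · exact (hGZK W h1).1
  · -- pass to a global minimal model `C • W`
    obtain ⟨C, hC⟩ := hasGlobalMinimalModel_rat_holds W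
    haveI := hC
    have hanC : (C • W).analyticRank = W.analyticRank := analyticRank_variableChange_holds W C
    have hrkC : (C • W).mordellWeilRank = W.mordellWeilRank :=
      mordellWeilRank_variableChange_holds W C
    have h2' : 2 ≤ (C • W).analyticRank := by omega
    have h3' : (C • W).analyticRank ≤ 3 := by omega
    obtain ⟨p, hp, hc0, hc1, hα, hβ⟩ := hDoors (C • W) h2' h3'
    have key : (C • W).mordellWeilRank = (C • W).analyticRank := by
      refine soloInformed_rank_eq_analyticRank_of_converses (C • W) p ?_ (hPar (C • W) p)
        (even_analyticRank_iff_rootNumber_eq_one_of_exists_isNewformOf (C • W) hmod) hα hβ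
      intro k hk hc
      have hk1 : k = 0 ∨ k = 1 := by omega
      rcases hk1 with rfl | rfl
      · exact hc0 hc
      · exact hc1 hc
    rwa [hanC, hrkC] at key

/-- **The summit from the `r_an ≤ 3` range and the `r_an ≥ 4` range.** [folklore] -/
theorem soloInformed_birchSwinnertonDyer_of_le_three_of_four_le
    (h3 : ∀ (W : WeierstrassCurve ℚ) [W.IsElliptic], W.analyticRank ≤ 3 →
      W.mordellWeilRank = W.analyticRank)
    (h4 : ∀ (W : WeierstrassCurve ℚ) [W.IsElliptic], 4 ≤ W.analyticRank →
      W.mordellWeilRank = W.analyticRank) :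
    BirchSwinnertonDyer := by
  unfold BirchSwinnertonDyer Literature.BSDRankConjecture
  intro W hW
  by_cases h : W.analyticRank ≤ 3
  · exact (h3 W h).symm
  · exact (h4 W (by omega)).symm

/-! ### The whole conjecture as a converse ladder -/

/-- **RANK from the converse ladder at one prime.** Over Gross–Zagier–Kolyvagin, modularity and
`p`-parity (theorems in print), the Birch–Swinnerton-Dyer rank conjecture follows from: for every
globally minimal `E/ℚ` with `r_an(E) = r ≥ 2` there is ONE prime `p` at which
(ladder) the corank-`k` `p`-converse `corank Sel_{p^∞} = k ⇒ r_an = k` holds for every `k ≤ r - 2`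
— in print for `k = 0` (main conjecture) and `k = 1` (Skinner, Burungale–Skinner–Tian–Wan, Kim)
and for no `k ≥ 2`;
(α) `corank_{ℤ_p} Sel_{p^∞}(E/ℚ) ≤ r` — by Kato's Thm. 18.4 implied by
`ord_{T=0} L_p(E,T) ≤ ord_{s=1} L(E,s)`, open beyond order `1`;
(β) `corank_{ℤ_p} Ш(E/ℚ)[p^∞] = 0` — open whenever no rational point of infinite order is given.
[cite: GrossPCMS2011, Thm. 3.3] [cite: DokchitserDokchitserAnnals2010, Thm. 1.4] -/
theorem soloInformed_birchSwinnertonDyer_of_converseLadder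
    (hGZK : rank_eq_analyticRank_of_analyticRank_le_one)
    (hmod : exists_isNewformOf)
    (hPar : ∀ (W : WeierstrassCurve ℚ) [W.IsElliptic] (p : ℕ) [Fact p.Prime], p_parity W p)
    (hLadder : ∀ (W : WeierstrassCurve ℚ) [W.IsElliptic] [W.IsGloballyMinimal],
      2 ≤ W.analyticRank →
      ∃ (p : ℕ) (_ : Fact p.Prime),
        (∀ k : ℕ, k + 2 ≤ W.analyticRank → W.selmerCorank p = k → W.analyticRank = k) ∧
        W.selmerCorank p ≤ W.analyticRank ∧ W.shaCorank p = 0) :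
    BirchSwinnertonDyer := by
  unfold BirchSwinnertonDyer Literature.BSDRankConjecture
  intro W hW
  by_cases h1 : W.analyticRank ≤ 1
  · exact (hGZK W h1).1.symm
  · obtain ⟨C, hC⟩ := hasGlobalMinimalModel_rat_holds W
    haveI := hC
    have hanC : (C • W).analyticRank = W.analyticRank := analyticRank_variableChange_holds W C
    have hrkC : (C • W).mordellWeilRank = W.mordellWeilRank :=
      mordellWeilRank_variableChange_holds W C
    have h2' : 2 ≤ (C • W).analyticRank := by omega
    obtain ⟨p, hp, hconv, hα, hβ⟩ := hLadder (C • W) h2'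
    have key : (C • W).mordellWeilRank = (C • W).analyticRank :=
      soloInformed_rank_eq_analyticRank_of_converses (C • W) p hconv (hPar (C • W) p)
        (even_analyticRank_iff_rootNumber_eq_one_of_exists_isNewformOf (C • W) hmod) hα hβ
    rw [hanC, hrkC] at key
    exact key.symm

/-- **Conversely, the ladder is necessary**: `BirchSwinnertonDyer` together with finiteness of
`Ш` at one prime implies every rung — if `rank = r_an` for all curves then trivially
`corank Sel_{p^∞} = k ⇒ r_an = k` whenever `corank Ш[p^∞] = 0` at `p` (corank identity). So the
ladder-with-(β) is EQUIVALENT to RANK-with-(β); the content of the reduction is that the rungs are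
separately meaningful theorems-in-print for `k ≤ 1`. [cite: GreenbergLNM1716, §1] -/
theorem soloInformed_converse_of_birchSwinnertonDyer (h : BirchSwinnertonDyer)
    (W : WeierstrassCurve ℚ) [W.IsElliptic] (p : ℕ) [Fact p.Prime] (hβ : W.shaCorank p = 0)
    (k : ℕ) (hk : W.selmerCorank p = k) : W.analyticRank = k := by
  have hid : W.selmerCorank p = W.mordellWeilRank + W.shaCorank p :=
    W.selmerCorank_eq_mordellWeilRank_add_holds p
  have hr : W.analyticRank = W.mordellWeilRank := h W ‹_›
  omega

end Summit.BirchSwinnertonDyer.BirchSwinnertonDyer.Theorems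

end
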